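import Literature.RingTheory.Etale.OlivierWeaklyEtale
import Literature.RingTheory.Etale.PointedRetractionHenselian
import Literature.RingTheory.Etale.StrictHenselOfSplitting
import Literature.RingTheory.Etale.WeaklyEtaleZeroDim
import Literature.RingTheory.Etale.IndEtalePresentation
import Literature.RingTheory.Etale.WeaklyEtaleDirectLimit
import Literature.RingTheory.Etale.WeaklyEtaleCancel
import Literature.RingTheory.Etale.IndEtaleField

/-!
# Weakly étale algebras over rings in which étale covers split are Zariski-locally trivial

[cite: StacksProject, Tag 097Z (proof), Tags 097X, 092Z; BhattScholze2015 = arXiv:1309.1198v2,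
Theorem 2.3.4 and its proof]

Let `C` be a ring such that every faithfully flat étale `C`-algebra has a retraction (e.g. the
étale tower of Bhatt–Scholze), and let `C → D` be weakly étale.  If `x ⊂ D` is a prime whose
contraction `𝔪 = x ∩ C` is a maximal ideal, then `C_𝔪 → D_x` is bijective
(`bijective_localRingHom_of_retraction`): `C_𝔪` has separably closed residue field and integral
domains over it are local (`PointedRetractionHenselian`, from the pointed retractions of
Stacks 097X), and Olivier's theorem (`OlivierWeaklyEtale`) applies to the local weakly étale
map `C_𝔪 → D_x`.

We also record that ind-étale (`FactorsEtale`) algebras are weakly étale and that over such an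
algebra primes lying over maximal ideals are maximal (zero-dimensional fibres).
-/

universe u

namespace Literature.RingTheory.Etale

open TensorProduct IsLocalRing

noncomputable section

/-! ### Weak étaleness of ind-étale algebras -/

/-- Weak étaleness is invariant under `A`-algebra isomorphisms. [folklore] -/
theorem weaklyEtale_of_algEquiv {A S S' : Type u} [CommRing A] [CommRing S] [CommRing S']
    [Algebra A S] [Algebra A S'] [Algebra.WeaklyEtale A S] (e : S ≃ₐ[A] S') :
    Algebra.WeaklyEtale A S' where
  flat := Module.Flat.of_linearEquiv e.symm.toLinearEquiv
  flat_lmul' := by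
    have hcomp : (Algebra.TensorProduct.lmul' A (S := S')).toRingHom =
        (e.toAlgHom.toRingHom.comp (Algebra.TensorProduct.lmul' A (S := S)).toRingHom).comp
          (Algebra.TensorProduct.map e.symm.toAlgHom e.symm.toAlgHom).toRingHom := by
      ext x
      · change Algebra.TensorProduct.lmul' A (S := S') (x ⊗ₜ 1) =
          e (Algebra.TensorProduct.lmul' A (S := S) (e.symm x ⊗ₜ e.symm 1))
        rw [Algebra.TensorProduct.lmul'_apply_tmul, Algebra.TensorProduct.lmul'_apply_tmul,
          map_mul, e.apply_symm_apply, e.apply_symm_apply]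
      · change Algebra.TensorProduct.lmul' A (S := S') (1 ⊗ₜ x) =
          e (Algebra.TensorProduct.lmul' A (S := S) (e.symm 1 ⊗ₜ e.symm x))
        rw [Algebra.TensorProduct.lmul'_apply_tmul, Algebra.TensorProduct.lmul'_apply_tmul,
          map_mul, e.apply_symm_apply, e.apply_symm_apply]
    change (Algebra.TensorProduct.lmul' A (S := S')).toRingHom.Flat
    rw [hcomp]
    refine RingHom.Flat.comp (RingHom.Flat.of_bijective ?_) (RingHom.Flat.comp
      (Algebra.WeaklyEtale.flat_lmul' A S) (RingHom.Flat.of_bijective e.bijective))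
    exact (Algebra.TensorProduct.congr e.symm e.symm).bijective

/-- **Ind-étale algebras are weakly étale** (a directed colimit of étale algebras).
[cite: StacksProject, Tag 097N; BhattScholze2015, Prop. 2.3.3] -/
theorem FactorsEtale.weaklyEtale {A C : Type u} [CommRing A] [CommRing C] [Algebra A C]
    (h : FactorsEtale A C) : Algebra.WeaklyEtale A C := by
  obtain ⟨ι, _, _, _, G, _, _, _, f, _, ⟨e⟩⟩ := h.exists_directLimit_equiv
  haveI : Algebra.WeaklyEtale A (DirectLimit G f) := weaklyEtale_directLimit f
  exact weaklyEtale_of_algEquiv e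

/-! ### Primes over maximal ideals along weakly étale maps are maximal -/

/-- Along a weakly étale map, a prime lying over a maximal ideal is maximal (the fibres of a
weakly étale map are zero-dimensional). [cite: StacksProject, Tags 092F, 097Z] -/
theorem isMaximal_of_weaklyEtale_of_isMaximal_under {A C : Type u} [CommRing A] [CommRing C]
    [Algebra A C] [Algebra.WeaklyEtale A C] (Q : Ideal C) [Q.IsPrime]
    (hP : (Q.under A).IsMaximal) : Q.IsMaximal := by
  obtain ⟨Q', hQ'max, hQQ'⟩ := Ideal.exists_le_maximal Q (Ideal.IsPrime.ne_top inferInstance)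
  suffices hEq : Q = Q' by rw [hEq]; exact hQ'max
  set p := Q.under A
  haveI : Q'.LiesOver p := ⟨by
    refine (hP.eq_of_le (Ideal.IsPrime.ne_top inferInstance) ?_)
    exact Ideal.comap_mono hQQ'⟩
  haveI : Q.LiesOver p := ⟨rfl⟩
  -- pass to the fibre ring over `κ(p)`, which is zero-dimensional
  haveI : Ring.KrullDimLE 0 (p.Fiber C) :=
    krullDimLE_zero_of_weaklyEtale_field p.ResidueField (p.Fiber C)
  let φ := PrimeSpectrum.primesOverOrderIsoFiber A C p
  have hle : φ ⟨Q, inferInstance, inferInstance⟩ ≤ φ ⟨Q', hQ'max.isPrime, inferInstance⟩ :=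
    φ.le_iff_le.2 hQQ'
  have hmax : (φ ⟨Q, inferInstance, inferInstance⟩).asIdeal.IsMaximal :=
    Ideal.isMaximal_of_isPrime _
  have heq : φ ⟨Q, inferInstance, inferInstance⟩ = φ ⟨Q', hQ'max.isPrime, inferInstance⟩ :=
    PrimeSpectrum.ext (hmax.eq_of_le (Ideal.IsPrime.ne_top inferInstance) hle)
  exact congrArg Subtype.val (φ.injective heq)

/-! ### The local isomorphism -/

section LocalIso

variable {C : Type u} [CommRing C]
  (hret : ∀ (Y : Type u) [CommRing Y] [Algebra C Y] [Algebra.Etale C Y]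
    [Module.FaithfullyFlat C Y], Nonempty (Y →ₐ[C] C))

include hret in
/-- Pointed retractions at every maximal ideal (Stacks 097X, in the tree). [cite: StacksProject,
Tag 097X] -/
theorem hasPointedRetractions_of_retraction (m : Ideal C) [m.IsMaximal] :
    HasPointedRetractions C m := by
  intro Y _ _ _ q _ hq
  obtain ⟨φ, hφ⟩ := exists_algHom_localization_comap_eq hret m Y q (by
    rw [← Ideal.under_def]; exact hq)
  exact ⟨φ, hφ⟩

include hret in
/-- **Local triviality (Bhatt–Scholze 2.3.4, local step).**  Let every faithfully flat étale
`C`-algebra have a retraction and let `C → D` be weakly étale.  For a prime `x ⊂ D` whose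
contraction `𝔪 = x ∩ C` is maximal, `C_𝔪 → D_x` is bijective: `C_𝔪` has separably closed
residue field and integral domains over it are local (Stacks 04GG), so Olivier's theorem
applies to the local weakly étale map `C_𝔪 → D_x`.
[cite: StacksProject, Tag 097Z; BhattScholze2015, proof of Theorem 2.3.4] -/
theorem bijective_localRingHom_of_retraction {D : Type u} [CommRing D] [Algebra C D]
    [Algebra.WeaklyEtale C D] (x : Ideal D) [x.IsPrime] (hmax : (x.under C).IsMaximal) :
    Function.Bijective (Localization.localRingHom (x.under C) x (algebraMap C D) rfl) := by
  set m := x.under C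
  haveI : m.IsMaximal := hmax
  set R := Localization.AtPrime m
  set S := Localization.AtPrime x
  set f := Localization.localRingHom m x (algebraMap C D) rfl
  letI : Algebra R S := f.toAlgebra
  haveI : IsScalarTower C R S := IsScalarTower.of_algebraMap_eq fun c => by
    change algebraMap C S c = f (algebraMap C R c)
    rw [Localization.localRingHom_to_map, IsScalarTower.algebraMap_apply C D S]
  haveI : IsLocalHom (algebraMap R S) := Localization.isLocalHom_localRingHom m x _ rfl
  -- strict henselianity of `C_𝔪`
  have hPR : HasPointedRetractions C m := hasPointedRetractions_of_retraction hret m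
  haveI : IsSepClosed (ResidueField R) := isSepClosed_residueField hPR
  have hloc : ∀ (E : Type u) [CommRing E] [IsDomain E] [Algebra R E],
      Algebra.IsIntegral R E → IsLocalRing E :=
    fun E _ _ _ hint => isLocalRing_of_isDomain_of_isIntegral hPR E
  -- `C_𝔪 → D_x` is weakly étale
  haveI : Algebra.WeaklyEtale C S := Algebra.WeaklyEtale.trans C D S
  haveI : Algebra.WeaklyEtale R S := weaklyEtale_cancel C R S
  exact bijective_algebraMap_of_weaklyEtale R S hloc

end LocalIso

end

end Literature.RingTheory.Etale
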